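import Literature.Analysis.PDE.ParabolicHolderCompactness
import HarnessLib

/-!
# Local compactness of `2`-jets on parabolic spacetime (diagonal Arzelà–Ascoli)

Topic `Literature/Analysis/PDE` (continuation of `ParabolicHolderCompactness.lean`, which treats
the unit ball `B^{m,1}`).  For the blow-up arguments of the parabolic Schauder theory one needs
compactness on ALL of spacetime: a sequence `uᵢ` on `R^m × ℝ` whose `2`-jets
`(uᵢ, D uᵢ, D² uᵢ, ∂ₜ uᵢ)` are uniformly bounded and uniformly equicontinuous on every parabolic
ball `B(0, n+1)` has a subsequence whose jets converge uniformly on every ball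
(`exists_subseq_jets_tendstoUniformlyOn_forall_ball`), and the limits are the jets of the limit
function, which again satisfies the regularity guard `IsC21On` everywhere
(`isC21On_univ_of_jets_tendsto`, differentiation of locally uniform limits slice by slice, and
joint differentiability from the continuous partial derivatives).

* `exists_subseq_forall_tendstoUniformlyOn` — **the diagonal subsequence** (successive
  extractions `Ψₙ₊₁ = Ψₙ ∘ θₙ(Ψₙ)`, then `φ m = Ψ_{m+1} m`; index bookkeeping via Mathlib's
  `TendstoUniformlyOn.seq_tendstoUniformlyOn`);
* `exists_subseq_jets_tendstoUniformlyOn_ball` — Arzelà–Ascoli for the jets on one ball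
  (`Literature.Analysis.FunctionSpaces.exists_subseq_tendstoUniformlyOn_of_equicontinuous`, the
  jets taking values in a compact ball of the finite-dimensional jet space);
* `exists_subseq_jets_tendstoUniformlyOn_forall_ball` — the local compactness theorem (with
  continuity of the limits);
* `tendstoLocallyUniformlyOn_comp_of_forall_ball`, `tendsto_of_forall_ball`,
  `isC21On_univ_of_jets_tendsto` — identification of the limits;
* `exists_subseq_tendstoUniformlyOn_of_strictMono`,
  `exists_subseq_jets_tendstoUniformlyOn_forall_ball_of_eventually`,
  `isC21On_univ_of_jets_tendsto_of_eventually` — the same when, ball by ball, the hypotheses only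
  hold for large indices (expanding domains, White 2005 pp. 1499, 1505).

Everything is PROVED; no definitions, no named facts.

## References

* [Evans2010] L. C. Evans, *Partial Differential Equations*, 2nd ed., AMS 2010, App. C.7
  (Arzelà–Ascoli) — the diagonal argument is the standard one (W. Rudin, *Principles*, Thm. 7.23).
-/

noncomputable section

open Set Filter Metric Topology Function

namespace Literature.Analysis.PDE

open Parabolic Literature.Analysis.FunctionSpaces

/-! ### Index bookkeeping: subsequences and the diagonal argument -/

section Diagonal

variable {X Y : Type*} [UniformSpace Y]

/-- **The diagonal subsequence.**  Let `J i : X → Y` be a sequence of functions and `S n` a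
sequence of sets such that from every subsequence and for every `n` one can extract a further
subsequence converging uniformly on `S n`.  Then a single subsequence converges uniformly on every
`S n` (extract successively and take the diagonal). [folklore] -/
theorem exists_subseq_forall_tendstoUniformlyOn (J : ℕ → X → Y) (S : ℕ → Set X)
    (hex : ∀ (n : ℕ) (ψ : ℕ → ℕ), ∃ θ : ℕ → ℕ, StrictMono θ ∧
      ∃ g : X → Y, TendstoUniformlyOn (fun i => J (ψ (θ i))) g atTop (S n)) :
    ∃ φ : ℕ → ℕ, StrictMono φ ∧
      ∀ n, ∃ g : X → Y, TendstoUniformlyOn (fun i => J (φ i)) g atTop (S n) := by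
  choose θ hθ g hg using hex
  -- successive extractions: `Ψ 0 = id`, `Ψ (n+1) = Ψ n ∘ θ n (Ψ n)`
  let Ψ : ℕ → ℕ → ℕ := fun n => Nat.rec id (fun k ψk => ψk ∘ θ k ψk) n
  have hΨ0 : Ψ 0 = id := rfl
  have hΨs : ∀ n, Ψ (n + 1) = Ψ n ∘ θ n (Ψ n) := fun n => rfl
  have hΨm : ∀ n, StrictMono (Ψ n) := by
    intro n
    induction n with
    | zero => rw [hΨ0]; exact strictMono_id
    | succ k ih => rw [hΨs]; exact ih.comp (hθ k _)
  -- `Ψ (n + k) = Ψ n ∘ σ` with `σ` strictly monotone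
  have hfac : ∀ n k, ∃ σ : ℕ → ℕ, StrictMono σ ∧ Ψ (n + k) = Ψ n ∘ σ := by
    intro n k
    induction k with
    | zero => exact ⟨id, strictMono_id, rfl⟩
    | succ k ih =>
        obtain ⟨σ, hσ, hk⟩ := ih
        refine ⟨σ ∘ θ (n + k) (Ψ (n + k)), hσ.comp (hθ _ _), ?_⟩
        rw [← add_assoc, hΨs, hk]
        rfl
  -- the diagonal `φ m = Ψ (m+1) m`
  refine ⟨fun m => Ψ (m + 1) m, strictMono_nat_of_lt_succ fun m => ?_, fun n => ?_⟩
  · show Ψ (m + 1) m < Ψ (m + 1 + 1) (m + 1)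
    rw [hΨs (m + 1)]
    exact hΨm (m + 1) (lt_of_lt_of_le (Nat.lt_succ_self m) ((hθ _ _).id_le (m + 1)))
  · -- along the diagonal, the `n`-th convergence holds: `Ψ (m+1) m = Ψ (n+1) (τ m)`, `τ m ≥ m`
    refine ⟨g n (Ψ n), ?_⟩
    have key : ∀ m, n ≤ m → ∃ j, m ≤ j ∧ Ψ (m + 1) m = Ψ (n + 1) j := by
      intro m hm
      obtain ⟨σ, hσ, hk⟩ := hfac (n + 1) (m - n)
      have hidx : n + 1 + (m - n) = m + 1 := by omega
      rw [hidx] at hk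
      exact ⟨σ m, hσ.id_le m, by rw [hk]; rfl⟩
    choose! τ hτ hτeq using key
    have hτ' : Tendsto τ atTop atTop :=
      tendsto_atTop_mono' atTop ((eventually_ge_atTop n).mono fun m hm => hτ m hm) tendsto_id
    have hconv : TendstoUniformlyOn (fun i => J (Ψ (n + 1) i)) (g n (Ψ n)) atTop (S n) := by
      rw [hΨs]; exact hg n (Ψ n)
    refine (hconv.seq_tendstoUniformlyOn τ hτ').congr ?_
    filter_upwards [eventually_ge_atTop n] with m hm
    intro x _
    show J (Ψ (n + 1) (τ m)) x = J (Ψ (m + 1) m) x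
    rw [hτeq m hm]

end Diagonal

/-! ### Local compactness of jets -/

section Jets

variable {m : ℕ} {F : Type*} [NormedAddCommGroup F] [NormedSpace ℝ F] [FiniteDimensional ℝ F]

/-- **Arzelà–Ascoli for the `2`-jets on one parabolic ball**: if on the ball `B_R = B(0, R)` the
jets `(uᵢ, D uᵢ, D² uᵢ, ∂ₜ uᵢ)` of a sequence are uniformly bounded and uniformly equicontinuous,
a subsequence of the jets converges uniformly on `B_R`. [folklore] -/
theorem exists_subseq_jets_tendstoUniformlyOn_ball
    (u : ℕ → Parabolic (EuclideanSpace ℝ (Fin m)) → F) (R M : ℝ)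
    (hbd : ∀ i, ∀ X ∈ ball (0 : Parabolic (EuclideanSpace ℝ (Fin m))) R,
      ‖u i X‖ ≤ M ∧ ‖spaceDeriv (u i) X‖ ≤ M ∧ ‖spaceDeriv (spaceDeriv (u i)) X‖ ≤ M ∧
        ‖timeDeriv (u i) X‖ ≤ M)
    (heq : ∀ ε > (0 : ℝ), ∃ δ > (0 : ℝ), ∀ i,
      ∀ X ∈ ball (0 : Parabolic (EuclideanSpace ℝ (Fin m))) R,
      ∀ Y ∈ ball (0 : Parabolic (EuclideanSpace ℝ (Fin m))) R, dist X Y < δ →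
        ‖u i X - u i Y‖ ≤ ε ∧ ‖spaceDeriv (u i) X - spaceDeriv (u i) Y‖ ≤ ε ∧
          ‖spaceDeriv (spaceDeriv (u i)) X - spaceDeriv (spaceDeriv (u i)) Y‖ ≤ ε ∧
            ‖timeDeriv (u i) X - timeDeriv (u i) Y‖ ≤ ε) :
    ∃ φ : ℕ → ℕ, StrictMono φ ∧ ∃ G : Parabolic (EuclideanSpace ℝ (Fin m)) →
      F × (EuclideanSpace ℝ (Fin m) →L[ℝ] F) ×
        (EuclideanSpace ℝ (Fin m) →L[ℝ] EuclideanSpace ℝ (Fin m) →L[ℝ] F) × F,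
      TendstoUniformlyOn (fun i X => (u (φ i) X, spaceDeriv (u (φ i)) X,
        spaceDeriv (spaceDeriv (u (φ i))) X, timeDeriv (u (φ i)) X)) G atTop (ball 0 R) := by
  have hK := @isCompact_closedBall _ _ (FiniteDimensional.proper_real
    (F × (EuclideanSpace ℝ (Fin m) →L[ℝ] F) ×
        (EuclideanSpace ℝ (Fin m) →L[ℝ] EuclideanSpace ℝ (Fin m) →L[ℝ] F) × F)) 0 M
  have hfK : ∀ i, ∀ X ∈ ball (0 : Parabolic (EuclideanSpace ℝ (Fin m))) R,
      (u i X, spaceDeriv (u i) X, spaceDeriv (spaceDeriv (u i)) X, timeDeriv (u i) X) ∈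
        closedBall (0 : F × (EuclideanSpace ℝ (Fin m) →L[ℝ] F) ×
        (EuclideanSpace ℝ (Fin m) →L[ℝ] EuclideanSpace ℝ (Fin m) →L[ℝ] F) × F) M := by
    intro i X hX
    obtain ⟨h0, h1, h2, h3⟩ := hbd i X hX
    refine mem_closedBall_zero_iff.2 ?_
    simp only [Prod.norm_mk, max_le_iff]
    exact ⟨h0, h1, h2, h3⟩
  refine exists_subseq_tendstoUniformlyOn_of_equicontinuous (totallyBounded_ball 0 R) hK
    (fun i X => (u i X, spaceDeriv (u i) X, spaceDeriv (spaceDeriv (u i)) X, timeDeriv (u i) X))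
    hfK fun ε hε => ?_
  obtain ⟨δ, hδ, h⟩ := heq ε hε
  refine ⟨δ, hδ, fun i X hX Y hY hXY => ?_⟩
  obtain ⟨h0, h1, h2, h3⟩ := h i X hX Y hY hXY
  rw [Prod.dist_eq, Prod.dist_eq, Prod.dist_eq]
  simp only [max_le_iff]
  exact ⟨(dist_eq_norm _ _).trans_le h0, (dist_eq_norm _ _).trans_le h1,
    (dist_eq_norm _ _).trans_le h2, (dist_eq_norm _ _).trans_le h3⟩

/-- **Local compactness of the `2`-jets** (diagonal Arzelà–Ascoli): if on every ball
`B(0, n+1)` the jets `(uᵢ, D uᵢ, D² uᵢ, ∂ₜ uᵢ)` are uniformly bounded and uniformly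
equicontinuous, then along a subsequence the jets converge, uniformly on every ball, to limits
`v, V, V2, Z` which are continuous. [folklore] -/
theorem exists_subseq_jets_tendstoUniformlyOn_forall_ball
    (u : ℕ → Parabolic (EuclideanSpace ℝ (Fin m)) → F)
    (hbd : ∀ n : ℕ, ∃ M : ℝ, ∀ i, ∀ X ∈ ball (0 : Parabolic (EuclideanSpace ℝ (Fin m))) (n + 1),
      ‖u i X‖ ≤ M ∧ ‖spaceDeriv (u i) X‖ ≤ M ∧ ‖spaceDeriv (spaceDeriv (u i)) X‖ ≤ M ∧
        ‖timeDeriv (u i) X‖ ≤ M)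
    (heq : ∀ n : ℕ, ∀ ε > (0 : ℝ), ∃ δ > (0 : ℝ), ∀ i,
      ∀ X ∈ ball (0 : Parabolic (EuclideanSpace ℝ (Fin m))) (n + 1),
      ∀ Y ∈ ball (0 : Parabolic (EuclideanSpace ℝ (Fin m))) (n + 1), dist X Y < δ →
        ‖u i X - u i Y‖ ≤ ε ∧ ‖spaceDeriv (u i) X - spaceDeriv (u i) Y‖ ≤ ε ∧
          ‖spaceDeriv (spaceDeriv (u i)) X - spaceDeriv (spaceDeriv (u i)) Y‖ ≤ ε ∧
            ‖timeDeriv (u i) X - timeDeriv (u i) Y‖ ≤ ε) :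
    ∃ φ : ℕ → ℕ, StrictMono φ ∧ ∃ (v : Parabolic (EuclideanSpace ℝ (Fin m)) → F)
      (V : Parabolic (EuclideanSpace ℝ (Fin m)) → (EuclideanSpace ℝ (Fin m) →L[ℝ] F))
      (V2 : Parabolic (EuclideanSpace ℝ (Fin m)) →
        (EuclideanSpace ℝ (Fin m) →L[ℝ] EuclideanSpace ℝ (Fin m) →L[ℝ] F))
      (Z : Parabolic (EuclideanSpace ℝ (Fin m)) → F),
      Continuous v ∧ Continuous V ∧ Continuous V2 ∧ Continuous Z ∧
      ∀ n : ℕ, TendstoUniformlyOn (fun i => u (φ i)) v atTop (ball 0 (n + 1)) ∧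
        TendstoUniformlyOn (fun i => spaceDeriv (u (φ i))) V atTop (ball 0 (n + 1)) ∧
        TendstoUniformlyOn (fun i => spaceDeriv (spaceDeriv (u (φ i)))) V2 atTop (ball 0 (n + 1)) ∧
        TendstoUniformlyOn (fun i => timeDeriv (u (φ i))) Z atTop (ball 0 (n + 1)) := by
  -- the jet maps
  set J : ℕ → Parabolic (EuclideanSpace ℝ (Fin m)) →
      F × (EuclideanSpace ℝ (Fin m) →L[ℝ] F) ×
        (EuclideanSpace ℝ (Fin m) →L[ℝ] EuclideanSpace ℝ (Fin m) →L[ℝ] F) × F := fun i X =>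
    (u i X, spaceDeriv (u i) X, spaceDeriv (spaceDeriv (u i)) X, timeDeriv (u i) X) with hJ
  -- extraction on each ball, from any subsequence
  have hex : ∀ (n : ℕ) (ψ : ℕ → ℕ), ∃ θ : ℕ → ℕ, StrictMono θ ∧
      ∃ g, TendstoUniformlyOn (fun i => J (ψ (θ i))) g atTop (ball 0 (n + 1)) := by
    intro n ψ
    obtain ⟨M, hM⟩ := hbd n
    obtain ⟨θ, hθ, G, hG⟩ := exists_subseq_jets_tendstoUniformlyOn_ball (fun i => u (ψ i))
      (n + 1) M (fun i => hM (ψ i)) fun ε hε => by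
        obtain ⟨δ, hδ, h⟩ := heq n ε hε
        exact ⟨δ, hδ, fun i => h (ψ i)⟩
    exact ⟨θ, hθ, G, hG⟩
  obtain ⟨φ, hφ, hlim⟩ := exists_subseq_forall_tendstoUniformlyOn J (fun n => ball 0 (n + 1)) hex
  choose g hg using hlim
  -- the limits on the balls patch to a global limit
  set G : Parabolic (EuclideanSpace ℝ (Fin m)) →
      F × (EuclideanSpace ℝ (Fin m) →L[ℝ] F) ×
        (EuclideanSpace ℝ (Fin m) →L[ℝ] EuclideanSpace ℝ (Fin m) →L[ℝ] F) × F :=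
    fun X => limUnder atTop fun i => J (φ i) X with hG
  have hmem : ∀ X : Parabolic (EuclideanSpace ℝ (Fin m)), ∃ n : ℕ,
      X ∈ ball (0 : Parabolic (EuclideanSpace ℝ (Fin m))) (n + 1) := fun X => by
    obtain ⟨n, hn⟩ := exists_nat_gt (dist X 0)
    exact ⟨n, mem_ball.2 (by linarith)⟩
  have hGg : ∀ n : ℕ, ∀ X ∈ ball (0 : Parabolic (EuclideanSpace ℝ (Fin m))) (n + 1), G X = g n X :=
    fun n X hX => ((hg n).tendsto_at hX).limUnder_eq
  have hGconv : ∀ n : ℕ, TendstoUniformlyOn (fun i => J (φ i)) G atTop (ball 0 (n + 1)) :=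
    fun n => (hg n).congr_right fun X hX => (hGg n X hX).symm
  -- continuity of the global limit, from the uniform equicontinuity
  have hJc : ∀ (n : ℕ) i,
      ContinuousOn (J i) (ball (0 : Parabolic (EuclideanSpace ℝ (Fin m))) (n + 1)) := by
    intro n i
    refine (Metric.continuousOn_iff (f := J i)).2 fun X hX ε hε => ?_
    obtain ⟨δ, hδ, h⟩ := heq n (ε / 2) (half_pos hε)
    refine ⟨δ, hδ, fun Y hY hYX => ?_⟩
    obtain ⟨h0, h1, h2, h3⟩ := h i Y hY X hX hYX
    have hle : dist (J i Y) (J i X) ≤ ε / 2 := by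
      rw [hJ, Prod.dist_eq, Prod.dist_eq, Prod.dist_eq]
      simp only [max_le_iff]
      exact ⟨(dist_eq_norm _ _).trans_le h0, (dist_eq_norm _ _).trans_le h1,
        (dist_eq_norm _ _).trans_le h2, (dist_eq_norm _ _).trans_le h3⟩
    exact hle.trans_lt (half_lt_self hε)
  have hGc : Continuous G := by
    refine continuous_iff_continuousAt.2 fun X₀ => ?_
    obtain ⟨n, hn⟩ := hmem X₀
    exact ((hGconv n).continuousOn
      (Eventually.of_forall fun i => hJc n (φ i)).frequently).continuousAt
      (isOpen_ball.mem_nhds hn)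
  refine ⟨φ, hφ, fun X => (G X).1, fun X => (G X).2.1, fun X => (G X).2.2.1, fun X => (G X).2.2.2,
    continuous_fst.comp hGc, continuous_fst.comp (continuous_snd.comp hGc),
    continuous_fst.comp (continuous_snd.comp (continuous_snd.comp hGc)),
    continuous_snd.comp (continuous_snd.comp (continuous_snd.comp hGc)), fun n => ?_⟩
  have h := hGconv n
  refine ⟨uniformContinuous_fst.comp_tendstoUniformlyOn h,
    uniformContinuous_fst.comp_tendstoUniformlyOn (uniformContinuous_snd.comp_tendstoUniformlyOn h),
    uniformContinuous_fst.comp_tendstoUniformlyOn (uniformContinuous_snd.comp_tendstoUniformlyOn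
      (uniformContinuous_snd.comp_tendstoUniformlyOn h)),
    uniformContinuous_snd.comp_tendstoUniformlyOn (uniformContinuous_snd.comp_tendstoUniformlyOn
      (uniformContinuous_snd.comp_tendstoUniformlyOn h))⟩

/-- Uniform convergence on every parabolic ball `B(0, n+1)` gives locally uniform convergence of
the slices through any continuous map into spacetime. [folklore] -/
theorem tendstoLocallyUniformlyOn_comp_of_forall_ball {α Y : Type*} [TopologicalSpace α]
    [UniformSpace Y] {e : α → Parabolic (EuclideanSpace ℝ (Fin m))} (he : Continuous e)
    {Fs : ℕ → Parabolic (EuclideanSpace ℝ (Fin m)) → Y}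
    {G : Parabolic (EuclideanSpace ℝ (Fin m)) → Y}
    (h : ∀ n : ℕ, TendstoUniformlyOn Fs G atTop (ball 0 (n + 1))) :
    TendstoLocallyUniformlyOn (fun i a => Fs i (e a)) (fun a => G (e a)) atTop univ := by
  intro w hw a _
  obtain ⟨n, hn⟩ : ∃ n : ℕ, e a ∈ ball (0 : Parabolic (EuclideanSpace ℝ (Fin m))) (n + 1) := by
    obtain ⟨n, hn⟩ := exists_nat_gt (dist (e a) 0)
    exact ⟨n, mem_ball.2 (by linarith)⟩
  refine ⟨e ⁻¹' ball 0 (n + 1), mem_nhdsWithin_of_mem_nhds ((isOpen_ball.preimage he).mem_nhds hn),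
    ?_⟩
  filter_upwards [h n w hw] with i hi y hy using hi (e y) hy

/-- Pointwise convergence from uniform convergence on every ball. [folklore] -/
theorem tendsto_of_forall_ball {Y : Type*} [UniformSpace Y]
    {Fs : ℕ → Parabolic (EuclideanSpace ℝ (Fin m)) → Y}
    {G : Parabolic (EuclideanSpace ℝ (Fin m)) → Y}
    (h : ∀ n : ℕ, TendstoUniformlyOn Fs G atTop (ball 0 (n + 1)))
    (X : Parabolic (EuclideanSpace ℝ (Fin m))) : Tendsto (fun i => Fs i X) atTop (𝓝 (G X)) := by
  obtain ⟨n, hn⟩ := exists_nat_gt (dist X 0)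
  exact (h n).tendsto_at (mem_ball.2 (by linarith))

omit [FiniteDimensional ℝ F] in
/-- **Identification of the limits**: if the `uᵢ` satisfy the regularity guard everywhere and the
jets `(uᵢ, D uᵢ, D² uᵢ, ∂ₜ uᵢ)` converge uniformly on every ball to `(v, V, V2, Z)` with `V`, `Z`
continuous, then `v` satisfies the guard everywhere and `D v = V`, `D² v = V2`, `∂ₜ v = Z`
(differentiation of locally uniform limits, slice by slice). [folklore] -/
theorem isC21On_univ_of_jets_tendsto {u : ℕ → Parabolic (EuclideanSpace ℝ (Fin m)) → F}
    (hC : ∀ i, IsC21On (u i) univ) {v : Parabolic (EuclideanSpace ℝ (Fin m)) → F}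
    {V : Parabolic (EuclideanSpace ℝ (Fin m)) → (EuclideanSpace ℝ (Fin m) →L[ℝ] F)}
    {V2 : Parabolic (EuclideanSpace ℝ (Fin m)) →
      (EuclideanSpace ℝ (Fin m) →L[ℝ] EuclideanSpace ℝ (Fin m) →L[ℝ] F)}
    {Z : Parabolic (EuclideanSpace ℝ (Fin m)) → F} (hVc : Continuous V) (hZc : Continuous Z)
    (hv : ∀ n : ℕ, TendstoUniformlyOn u v atTop (ball 0 (n + 1)))
    (hV : ∀ n : ℕ, TendstoUniformlyOn (fun i => spaceDeriv (u i)) V atTop (ball 0 (n + 1)))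
    (hV2 : ∀ n : ℕ, TendstoUniformlyOn (fun i => spaceDeriv (spaceDeriv (u i))) V2 atTop
      (ball 0 (n + 1)))
    (hZ : ∀ n : ℕ, TendstoUniformlyOn (fun i => timeDeriv (u i)) Z atTop (ball 0 (n + 1))) :
    IsC21On v univ ∧ (∀ X, spaceDeriv v X = V X) ∧ (∀ X, spaceDeriv (spaceDeriv v) X = V2 X) ∧
      (∀ X, timeDeriv v X = Z X) := by
  have hex : ∀ t : ℝ, Continuous (fun x' : EuclideanSpace ℝ (Fin m) =>
      (⟨x', t⟩ : Parabolic (EuclideanSpace ℝ (Fin m)))) := fun t =>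
    (homeomorphProd (E := EuclideanSpace ℝ (Fin m))).symm.continuous.comp
      (continuous_id.prodMk continuous_const)
  have het : ∀ x : EuclideanSpace ℝ (Fin m), Continuous (fun t' : ℝ =>
      (⟨x, t'⟩ : Parabolic (EuclideanSpace ℝ (Fin m)))) := fun x =>
    (homeomorphProd (E := EuclideanSpace ℝ (Fin m))).symm.continuous.comp
      (continuous_const.prodMk continuous_id)
  -- space slices: `D v = V`
  have hDv : ∀ (x : EuclideanSpace ℝ (Fin m)) (t : ℝ),
      HasFDerivAt (fun x' => v ⟨x', t⟩) (V ⟨x, t⟩) x := fun x t =>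
    hasFDerivAt_of_tendstoLocallyUniformlyOn isOpen_univ
      (tendstoLocallyUniformlyOn_comp_of_forall_ball (hex t) hV)
      (fun i x' _ => (hC i).hasFDerivAt_space (mem_univ _))
      (fun x' _ => tendsto_of_forall_ball hv ⟨x', t⟩) (mem_univ x)
  have hsd : ∀ X, spaceDeriv v X = V X := fun X => (hDv X.x X.t).fderiv
  -- `D V = V2`
  have hDV : ∀ (x : EuclideanSpace ℝ (Fin m)) (t : ℝ),
      HasFDerivAt (fun x' => V ⟨x', t⟩) (V2 ⟨x, t⟩) x := fun x t =>
    hasFDerivAt_of_tendstoLocallyUniformlyOn isOpen_univ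
      (tendstoLocallyUniformlyOn_comp_of_forall_ball (hex t) hV2)
      (fun i x' _ => (hC i).hasFDerivAt_spaceDeriv (mem_univ _))
      (fun x' _ => tendsto_of_forall_ball hV ⟨x', t⟩) (mem_univ x)
  have hDsd : ∀ (x : EuclideanSpace ℝ (Fin m)) (t : ℝ),
      HasFDerivAt (fun x' => spaceDeriv v ⟨x', t⟩) (V2 ⟨x, t⟩) x := fun x t => by
    have hfun : (fun x' => spaceDeriv v ⟨x', t⟩) = fun x' => V ⟨x', t⟩ := funext fun x' => hsd _
    rw [hfun]; exact hDV x t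
  -- time slices: `∂ₜ v = Z`
  have hDt : ∀ (x : EuclideanSpace ℝ (Fin m)) (t : ℝ),
      HasDerivAt (fun t' => v ⟨x, t'⟩) (Z ⟨x, t⟩) t := fun x t =>
    hasDerivAt_of_tendstoLocallyUniformlyOn isOpen_univ
      (tendstoLocallyUniformlyOn_comp_of_forall_ball (het x) hZ)
      (Eventually.of_forall fun i t' _ => (hC i).hasDerivAt_time (mem_univ _))
      (fun t' _ => tendsto_of_forall_ball hv ⟨x, t'⟩) (mem_univ t)
  refine ⟨⟨fun X _ => ?_, fun X _ => (hDsd X.x X.t).differentiableAt⟩, hsd,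
    fun X => (hDsd X.x X.t).fderiv, fun X => (hDt X.x X.t).deriv⟩
  -- joint differentiability from the continuous partial derivatives
  have hsymm : ContinuousAt (fun q : EuclideanSpace ℝ (Fin m) × ℝ =>
      (⟨q.1, q.2⟩ : Parabolic (EuclideanSpace ℝ (Fin m)))) (X.x, X.t) :=
    (homeomorphProd (E := EuclideanSpace ℝ (Fin m))).symm.continuous.continuousAt
  have h3 : Continuous fun z : F => (1 : ℝ →L[ℝ] ℝ).smulRight z :=
    (ContinuousLinearMap.smulRightL ℝ ℝ F (1 : ℝ →L[ℝ] ℝ)).continuous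
  have hst := hasStrictFDerivAt_uncurry_coprod (𝕜 := ℝ) (u := (X.x, X.t))
    (f := fun x t => v ⟨x, t⟩) (f₁ := fun x t => V ⟨x, t⟩)
    (f₂ := fun x t => (1 : ℝ →L[ℝ] ℝ).smulRight (Z ⟨x, t⟩))
    (Eventually.of_forall fun q => hDv q.1 q.2)
    (Eventually.of_forall fun q => (hDt q.1 q.2).hasFDerivAt)
    (ContinuousAt.comp (g := V) hVc.continuousAt hsymm)
    (h3.continuousAt.comp (ContinuousAt.comp (g := Z) hZc.continuousAt hsymm))
  exact hst.hasFDerivAt.differentiableAt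

/-! ### Eventual versions (hypotheses only for large indices, ball by ball)

In the expanding-domain blow-up (White 2005, pp. 1499 and 1505) the rescaled functions are only
defined — and controlled — on balls `B(0, Rᵢ)` with `Rᵢ → ∞`; so on a fixed ball `B(0, n+1)` the
bounds hold only for `i ≥ N₀(n)`.  The diagonal argument is insensitive to this. -/

omit [FiniteDimensional ℝ F] in
/-- Sub-subsequence extraction along an ARBITRARY reindexing `ψ` from extraction along strictly
monotone ones: an unbounded `ψ` has a strictly monotone reparametrization, a bounded one takes some
value infinitely often (and a constant sequence converges uniformly). [folklore] -/
theorem exists_subseq_tendstoUniformlyOn_of_strictMono {X' Y' : Type*} [UniformSpace Y']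
    {J : ℕ → X' → Y'} {S : Set X'}
    (h : ∀ ψ : ℕ → ℕ, StrictMono ψ → ∃ θ : ℕ → ℕ, StrictMono θ ∧
      ∃ g : X' → Y', TendstoUniformlyOn (fun i => J (ψ (θ i))) g atTop S)
    (ψ : ℕ → ℕ) :
    ∃ θ : ℕ → ℕ, StrictMono θ ∧
      ∃ g : X' → Y', TendstoUniformlyOn (fun i => J (ψ (θ i))) g atTop S := by
  by_cases hc : ∃ c, ∃ᶠ i in atTop, ψ i = c
  · obtain ⟨c, hc⟩ := hc
    obtain ⟨θ, hθ, hθc⟩ := extraction_of_frequently_atTop hc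
    refine ⟨θ, hθ, J c, fun w hw => Eventually.of_forall fun i x _ => ?_⟩
    show (J c x, J (ψ (θ i)) x) ∈ w
    rw [hθc i]
    exact refl_mem_uniformity hw
  · push Not at hc
    have hT : Tendsto ψ atTop atTop := by
      refine tendsto_atTop.2 fun b => ?_
      have hall : ∀ᶠ i in atTop, ∀ c ∈ Finset.range b, ψ i ≠ c :=
        (Finset.eventually_all _).2 fun c _ => hc c
      filter_upwards [hall] with i hi
      by_contra hlt
      exact hi (ψ i) (Finset.mem_range.2 (lt_of_not_ge hlt)) rfl
    obtain ⟨θ₀, hθ₀, hmono⟩ := strictMono_subseq_of_tendsto_atTop hT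
    obtain ⟨θ₁, hθ₁, g, hg⟩ := h (ψ ∘ θ₀) hmono
    exact ⟨θ₀ ∘ θ₁, hθ₀.comp hθ₁, g, hg⟩

/-- **Local compactness of the `2`-jets, eventual form**: as
`exists_subseq_jets_tendstoUniformlyOn_forall_ball`, but on each ball `B(0, n+1)` the uniform
bound and the uniform equicontinuity are only required for indices `i ≥ N₀(n)`. [folklore] -/
theorem exists_subseq_jets_tendstoUniformlyOn_forall_ball_of_eventually
    (u : ℕ → Parabolic (EuclideanSpace ℝ (Fin m)) → F)
    (hN : ∀ n : ℕ, ∃ N₀ : ℕ,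
      (∃ M : ℝ, ∀ i, N₀ ≤ i → ∀ X ∈ ball (0 : Parabolic (EuclideanSpace ℝ (Fin m))) (n + 1),
        ‖u i X‖ ≤ M ∧ ‖spaceDeriv (u i) X‖ ≤ M ∧ ‖spaceDeriv (spaceDeriv (u i)) X‖ ≤ M ∧
          ‖timeDeriv (u i) X‖ ≤ M) ∧
      (∀ ε > (0 : ℝ), ∃ δ > (0 : ℝ), ∀ i, N₀ ≤ i →
        ∀ X ∈ ball (0 : Parabolic (EuclideanSpace ℝ (Fin m))) (n + 1),
        ∀ Y ∈ ball (0 : Parabolic (EuclideanSpace ℝ (Fin m))) (n + 1), dist X Y < δ →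
          ‖u i X - u i Y‖ ≤ ε ∧ ‖spaceDeriv (u i) X - spaceDeriv (u i) Y‖ ≤ ε ∧
            ‖spaceDeriv (spaceDeriv (u i)) X - spaceDeriv (spaceDeriv (u i)) Y‖ ≤ ε ∧
              ‖timeDeriv (u i) X - timeDeriv (u i) Y‖ ≤ ε)) :
    ∃ φ : ℕ → ℕ, StrictMono φ ∧ ∃ (v : Parabolic (EuclideanSpace ℝ (Fin m)) → F)
      (V : Parabolic (EuclideanSpace ℝ (Fin m)) → (EuclideanSpace ℝ (Fin m) →L[ℝ] F))
      (V2 : Parabolic (EuclideanSpace ℝ (Fin m)) →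
        (EuclideanSpace ℝ (Fin m) →L[ℝ] EuclideanSpace ℝ (Fin m) →L[ℝ] F))
      (Z : Parabolic (EuclideanSpace ℝ (Fin m)) → F),
      Continuous v ∧ Continuous V ∧ Continuous V2 ∧ Continuous Z ∧
      ∀ n : ℕ, TendstoUniformlyOn (fun i => u (φ i)) v atTop (ball 0 (n + 1)) ∧
        TendstoUniformlyOn (fun i => spaceDeriv (u (φ i))) V atTop (ball 0 (n + 1)) ∧
        TendstoUniformlyOn (fun i => spaceDeriv (spaceDeriv (u (φ i)))) V2 atTop (ball 0 (n + 1)) ∧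
        TendstoUniformlyOn (fun i => timeDeriv (u (φ i))) Z atTop (ball 0 (n + 1)) := by
  -- the jet maps
  set J : ℕ → Parabolic (EuclideanSpace ℝ (Fin m)) →
      F × (EuclideanSpace ℝ (Fin m) →L[ℝ] F) ×
        (EuclideanSpace ℝ (Fin m) →L[ℝ] EuclideanSpace ℝ (Fin m) →L[ℝ] F) × F := fun i X =>
    (u i X, spaceDeriv (u i) X, spaceDeriv (spaceDeriv (u i)) X, timeDeriv (u i) X) with hJ
  choose N₀ hN₀ using hN
  -- extraction on each ball, from any subsequence (applied to the tail `i ≥ N₀ n`)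
  have hex : ∀ (n : ℕ) (ψ : ℕ → ℕ), ∃ θ : ℕ → ℕ, StrictMono θ ∧
      ∃ g, TendstoUniformlyOn (fun i => J (ψ (θ i))) g atTop (ball 0 (n + 1)) := by
    intro n
    refine exists_subseq_tendstoUniformlyOn_of_strictMono fun ψ hψ => ?_
    obtain ⟨⟨M, hM⟩, heq⟩ := hN₀ n
    have hge : ∀ i, N₀ n ≤ ψ (i + N₀ n) := fun i =>
      le_trans (Nat.le_add_left _ _) (hψ.id_le _)
    obtain ⟨θ, hθ, G, hG⟩ := exists_subseq_jets_tendstoUniformlyOn_ball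
      (fun i => u (ψ (i + N₀ n))) (n + 1) M (fun i => hM _ (hge i)) fun ε hε => by
        obtain ⟨δ, hδ, h⟩ := heq ε hε
        exact ⟨δ, hδ, fun i => h _ (hge i)⟩
    exact ⟨fun i => θ i + N₀ n, fun a b hab => Nat.add_lt_add_right (hθ hab) _, G, hG⟩
  obtain ⟨φ, hφ, hlim⟩ := exists_subseq_forall_tendstoUniformlyOn J (fun n => ball 0 (n + 1)) hex
  choose g hg using hlim
  -- the limits on the balls patch to a global limit
  set G : Parabolic (EuclideanSpace ℝ (Fin m)) →
      F × (EuclideanSpace ℝ (Fin m) →L[ℝ] F) ×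
        (EuclideanSpace ℝ (Fin m) →L[ℝ] EuclideanSpace ℝ (Fin m) →L[ℝ] F) × F :=
    fun X => limUnder atTop fun i => J (φ i) X with hG
  have hmem : ∀ X : Parabolic (EuclideanSpace ℝ (Fin m)), ∃ n : ℕ,
      X ∈ ball (0 : Parabolic (EuclideanSpace ℝ (Fin m))) (n + 1) := fun X => by
    obtain ⟨n, hn⟩ := exists_nat_gt (dist X 0)
    exact ⟨n, mem_ball.2 (by linarith)⟩
  have hGg : ∀ n : ℕ, ∀ X ∈ ball (0 : Parabolic (EuclideanSpace ℝ (Fin m))) (n + 1), G X = g n X :=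
    fun n X hX => ((hg n).tendsto_at hX).limUnder_eq
  have hGconv : ∀ n : ℕ, TendstoUniformlyOn (fun i => J (φ i)) G atTop (ball 0 (n + 1)) :=
    fun n => (hg n).congr_right fun X hX => (hGg n X hX).symm
  -- continuity of the global limit, from the eventual uniform equicontinuity
  have hJc : ∀ (n : ℕ) i, N₀ n ≤ i →
      ContinuousOn (J i) (ball (0 : Parabolic (EuclideanSpace ℝ (Fin m))) (n + 1)) := by
    intro n i hi
    refine (Metric.continuousOn_iff (f := J i)).2 fun X hX ε hε => ?_
    obtain ⟨δ, hδ, h⟩ := (hN₀ n).2 (ε / 2) (half_pos hε)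
    refine ⟨δ, hδ, fun Y hY hYX => ?_⟩
    obtain ⟨h0, h1, h2, h3⟩ := h i hi Y hY X hX hYX
    have hle : dist (J i Y) (J i X) ≤ ε / 2 := by
      rw [hJ, Prod.dist_eq, Prod.dist_eq, Prod.dist_eq]
      simp only [max_le_iff]
      exact ⟨(dist_eq_norm _ _).trans_le h0, (dist_eq_norm _ _).trans_le h1,
        (dist_eq_norm _ _).trans_le h2, (dist_eq_norm _ _).trans_le h3⟩
    exact hle.trans_lt (half_lt_self hε)
  have hGc : Continuous G := by
    refine continuous_iff_continuousAt.2 fun X₀ => ?_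
    obtain ⟨n, hn⟩ := hmem X₀
    have hev : ∀ᶠ i in atTop, ContinuousOn (J (φ i))
        (ball (0 : Parabolic (EuclideanSpace ℝ (Fin m))) (n + 1)) := by
      filter_upwards [eventually_ge_atTop (N₀ n)] with i hi
      exact hJc n (φ i) (hi.trans (hφ.id_le i))
    exact ((hGconv n).continuousOn hev.frequently).continuousAt (isOpen_ball.mem_nhds hn)
  refine ⟨φ, hφ, fun X => (G X).1, fun X => (G X).2.1, fun X => (G X).2.2.1, fun X => (G X).2.2.2,
    continuous_fst.comp hGc, continuous_fst.comp (continuous_snd.comp hGc),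
    continuous_fst.comp (continuous_snd.comp (continuous_snd.comp hGc)),
    continuous_snd.comp (continuous_snd.comp (continuous_snd.comp hGc)), fun n => ?_⟩
  have h := hGconv n
  refine ⟨uniformContinuous_fst.comp_tendstoUniformlyOn h,
    uniformContinuous_fst.comp_tendstoUniformlyOn (uniformContinuous_snd.comp_tendstoUniformlyOn h),
    uniformContinuous_fst.comp_tendstoUniformlyOn (uniformContinuous_snd.comp_tendstoUniformlyOn
      (uniformContinuous_snd.comp_tendstoUniformlyOn h)),
    uniformContinuous_snd.comp_tendstoUniformlyOn (uniformContinuous_snd.comp_tendstoUniformlyOn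
      (uniformContinuous_snd.comp_tendstoUniformlyOn h))⟩

omit [FiniteDimensional ℝ F] in
/-- **Identification of the limits, eventual form**: as `isC21On_univ_of_jets_tendsto`, but the
regularity guard of `uᵢ` is only required on `B(0, n+1)` for `i ≥ N₀(n)`. [folklore] -/
theorem isC21On_univ_of_jets_tendsto_of_eventually
    {u : ℕ → Parabolic (EuclideanSpace ℝ (Fin m)) → F}
    (hC : ∀ n : ℕ, ∃ N₀ : ℕ, ∀ i, N₀ ≤ i →
      IsC21On (u i) (ball (0 : Parabolic (EuclideanSpace ℝ (Fin m))) (n + 1)))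
    {v : Parabolic (EuclideanSpace ℝ (Fin m)) → F}
    {V : Parabolic (EuclideanSpace ℝ (Fin m)) → (EuclideanSpace ℝ (Fin m) →L[ℝ] F)}
    {V2 : Parabolic (EuclideanSpace ℝ (Fin m)) →
      (EuclideanSpace ℝ (Fin m) →L[ℝ] EuclideanSpace ℝ (Fin m) →L[ℝ] F)}
    {Z : Parabolic (EuclideanSpace ℝ (Fin m)) → F} (hVc : Continuous V) (hZc : Continuous Z)
    (hv : ∀ n : ℕ, TendstoUniformlyOn u v atTop (ball 0 (n + 1)))
    (hV : ∀ n : ℕ, TendstoUniformlyOn (fun i => spaceDeriv (u i)) V atTop (ball 0 (n + 1)))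
    (hV2 : ∀ n : ℕ, TendstoUniformlyOn (fun i => spaceDeriv (spaceDeriv (u i))) V2 atTop
      (ball 0 (n + 1)))
    (hZ : ∀ n : ℕ, TendstoUniformlyOn (fun i => timeDeriv (u i)) Z atTop (ball 0 (n + 1))) :
    IsC21On v univ ∧ (∀ X, spaceDeriv v X = V X) ∧ (∀ X, spaceDeriv (spaceDeriv v) X = V2 X) ∧
      (∀ X, timeDeriv v X = Z X) := by
  have hex : ∀ t : ℝ, Continuous (fun x' : EuclideanSpace ℝ (Fin m) =>
      (⟨x', t⟩ : Parabolic (EuclideanSpace ℝ (Fin m)))) := fun t =>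
    (homeomorphProd (E := EuclideanSpace ℝ (Fin m))).symm.continuous.comp
      (continuous_id.prodMk continuous_const)
  have het : ∀ x : EuclideanSpace ℝ (Fin m), Continuous (fun t' : ℝ =>
      (⟨x, t'⟩ : Parabolic (EuclideanSpace ℝ (Fin m)))) := fun x =>
    (homeomorphProd (E := EuclideanSpace ℝ (Fin m))).symm.continuous.comp
      (continuous_const.prodMk continuous_id)
  choose N₀ hN₀ using hC
  -- every point lies in some ball `B(0, n+1)`
  have hmem : ∀ X : Parabolic (EuclideanSpace ℝ (Fin m)), ∃ n : ℕ,
      X ∈ ball (0 : Parabolic (EuclideanSpace ℝ (Fin m))) (n + 1) := fun X => by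
    obtain ⟨n, hn⟩ := exists_nat_gt (dist X 0)
    exact ⟨n, mem_ball.2 (by linarith)⟩
  -- the open slices of the balls
  have hsx : ∀ (t : ℝ) (n : ℕ), IsOpen {x' : EuclideanSpace ℝ (Fin m) |
      (⟨x', t⟩ : Parabolic (EuclideanSpace ℝ (Fin m))) ∈
        ball (0 : Parabolic (EuclideanSpace ℝ (Fin m))) (n + 1)} := fun t n =>
    isOpen_ball.preimage (hex t)
  have hst : ∀ (x : EuclideanSpace ℝ (Fin m)) (n : ℕ), IsOpen {t' : ℝ |
      (⟨x, t'⟩ : Parabolic (EuclideanSpace ℝ (Fin m))) ∈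
        ball (0 : Parabolic (EuclideanSpace ℝ (Fin m))) (n + 1)} := fun x n =>
    isOpen_ball.preimage (het x)
  -- space slices: `D v = V`
  have hDv : ∀ (x : EuclideanSpace ℝ (Fin m)) (t : ℝ),
      HasFDerivAt (fun x' => v ⟨x', t⟩) (V ⟨x, t⟩) x := by
    intro x t
    obtain ⟨n, hn⟩ := hmem ⟨x, t⟩
    refine hasFDerivAt_of_tendstoLocallyUniformlyOn (l := atTop) (hsx t n)
      (f := fun i x' => u (i + N₀ n) ⟨x', t⟩) (f' := fun i x' => spaceDeriv (u (i + N₀ n)) ⟨x', t⟩)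
      (g := fun x' => v ⟨x', t⟩) (g' := fun x' => V ⟨x', t⟩)
      ?_ (fun i x' hx' => (hN₀ n _ (Nat.le_add_left _ _)).hasFDerivAt_space hx') ?_ hn
    · exact ((tendstoLocallyUniformlyOn_comp_of_forall_ball (hex t) fun k =>
        (hV k).seq_tendstoUniformlyOn _ (tendsto_add_atTop_nat (N₀ n))).mono (subset_univ _))
    · exact fun x' _ => (tendsto_of_forall_ball hv ⟨x', t⟩).comp (tendsto_add_atTop_nat (N₀ n))
  have hsd : ∀ X, spaceDeriv v X = V X := fun X => (hDv X.x X.t).fderiv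
  -- `D V = V2`
  have hDV : ∀ (x : EuclideanSpace ℝ (Fin m)) (t : ℝ),
      HasFDerivAt (fun x' => V ⟨x', t⟩) (V2 ⟨x, t⟩) x := by
    intro x t
    obtain ⟨n, hn⟩ := hmem ⟨x, t⟩
    refine hasFDerivAt_of_tendstoLocallyUniformlyOn (l := atTop) (hsx t n)
      (f := fun i x' => spaceDeriv (u (i + N₀ n)) ⟨x', t⟩)
      (f' := fun i x' => spaceDeriv (spaceDeriv (u (i + N₀ n))) ⟨x', t⟩)
      (g := fun x' => V ⟨x', t⟩) (g' := fun x' => V2 ⟨x', t⟩)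
      ?_ (fun i x' hx' => (hN₀ n _ (Nat.le_add_left _ _)).hasFDerivAt_spaceDeriv hx') ?_ hn
    · exact ((tendstoLocallyUniformlyOn_comp_of_forall_ball (hex t) fun k =>
        (hV2 k).seq_tendstoUniformlyOn _ (tendsto_add_atTop_nat (N₀ n))).mono (subset_univ _))
    · exact fun x' _ => (tendsto_of_forall_ball hV ⟨x', t⟩).comp (tendsto_add_atTop_nat (N₀ n))
  have hDsd : ∀ (x : EuclideanSpace ℝ (Fin m)) (t : ℝ),
      HasFDerivAt (fun x' => spaceDeriv v ⟨x', t⟩) (V2 ⟨x, t⟩) x := fun x t => by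
    have hfun : (fun x' => spaceDeriv v ⟨x', t⟩) = fun x' => V ⟨x', t⟩ := funext fun x' => hsd _
    rw [hfun]; exact hDV x t
  -- time slices: `∂ₜ v = Z`
  have hDt : ∀ (x : EuclideanSpace ℝ (Fin m)) (t : ℝ),
      HasDerivAt (fun t' => v ⟨x, t'⟩) (Z ⟨x, t⟩) t := by
    intro x t
    obtain ⟨n, hn⟩ := hmem ⟨x, t⟩
    refine hasDerivAt_of_tendstoLocallyUniformlyOn (l := atTop) (hst x n)
      (f := fun i t' => u (i + N₀ n) ⟨x, t'⟩) (f' := fun i t' => timeDeriv (u (i + N₀ n)) ⟨x, t'⟩)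
      (g := fun t' => v ⟨x, t'⟩) (g' := fun t' => Z ⟨x, t'⟩)
      ?_ (Eventually.of_forall fun i t' ht' =>
        (hN₀ n _ (Nat.le_add_left _ _)).hasDerivAt_time ht') ?_ hn
    · exact ((tendstoLocallyUniformlyOn_comp_of_forall_ball (het x) fun k =>
        (hZ k).seq_tendstoUniformlyOn _ (tendsto_add_atTop_nat (N₀ n))).mono (subset_univ _))
    · exact fun t' _ => (tendsto_of_forall_ball hv ⟨x, t'⟩).comp (tendsto_add_atTop_nat (N₀ n))
  refine ⟨⟨fun X _ => ?_, fun X _ => (hDsd X.x X.t).differentiableAt⟩, hsd,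
    fun X => (hDsd X.x X.t).fderiv, fun X => (hDt X.x X.t).deriv⟩
  -- joint differentiability from the continuous partial derivatives
  have hsymm : ContinuousAt (fun q : EuclideanSpace ℝ (Fin m) × ℝ =>
      (⟨q.1, q.2⟩ : Parabolic (EuclideanSpace ℝ (Fin m)))) (X.x, X.t) :=
    (homeomorphProd (E := EuclideanSpace ℝ (Fin m))).symm.continuous.continuousAt
  have h3 : Continuous fun z : F => (1 : ℝ →L[ℝ] ℝ).smulRight z :=
    (ContinuousLinearMap.smulRightL ℝ ℝ F (1 : ℝ →L[ℝ] ℝ)).continuous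
  have hstr := hasStrictFDerivAt_uncurry_coprod (𝕜 := ℝ) (u := (X.x, X.t))
    (f := fun x t => v ⟨x, t⟩) (f₁ := fun x t => V ⟨x, t⟩)
    (f₂ := fun x t => (1 : ℝ →L[ℝ] ℝ).smulRight (Z ⟨x, t⟩))
    (Eventually.of_forall fun q => hDv q.1 q.2)
    (Eventually.of_forall fun q => (hDt q.1 q.2).hasFDerivAt)
    (ContinuousAt.comp (g := V) hVc.continuousAt hsymm)
    (h3.continuousAt.comp (ContinuousAt.comp (g := Z) hZc.continuousAt hsymm))
  exact hstr.hasFDerivAt.differentiableAt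

end Jets

end Literature.Analysis.PDE
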